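import Summits.ValiantsHypothesis.ValiantsHypothesis.Theorems.DepthWindowSlopeRate
import HarnessLib

/-!
# Route `DepthWindow`, g7 — the kernel FLOOR of the rate dial: `HomImmHardAt p 0` and `HomImmHardAt 0 q`

The hard side `HomImmHardAt p q` of the slope–rate dial (`DepthWindowSlopeRate.lean`) is a down-set
in the slope `p/q`; its bottom, slope `0` — homogeneous circuits of CONSTANT product-depth `c` for
`IMM_{m,⌊√⌊log₂ m⌋⌋}` have more than `m^c + c` gates from some `m₀(c)` on — is a theorem of the tree's
Limaye–Srinivasan–Tavenas fact (`lst_constantDepth_imm_lower_bound_holds`, constant depth,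
`d₀ ≤ d ≤ ε log n`, size `≥ n^{d^δ}`), even WITHOUT the homogeneity hypothesis.  This module does the
asymptotic bookkeeping at the dial's own degree function `d(m) = ⌊√⌊log₂ m⌋⌋`
(`sqrt_log_window_arith`: from some `m₀` on, `d₀ ≤ d(m) ≤ ε ln m` and `m^c + c < m^{d(m)^δ}`) and
records the floor: `immHard_constDepth` (general circuits), `homImmHardAt_zero_right : HomImmHardAt p 0`,
`homImmHardAt_zero_left : HomImmHardAt 0 q`.  Print reaches slope `< 1.4404` (BDS 2024 Thm. 2); the
kernel reaches slope `0` here and slope `< 1/2` in the permanent frame (`perHardBelowHalf`).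
[cite: LimayeSrinivasanTavenas2025, Cor. 4] [cite: BhargavDuttaSaxena2024, Thm. 1.4, Rem. 1.5]
-/

-- layout Summits/ValiantsHypothesis/ValiantsHypothesis forces the duplicated namespace component
set_option linter.dupNamespace false

namespace Summit.ValiantsHypothesis.ValiantsHypothesis.Theorems.DepthWindow

open MvPolynomial Real Literature.Computability.AlgebraicComplexity ArithCircuit
open Literature.Computability.Complexity

noncomputable section

/-- **Arithmetic of the dial's degree function** `d(m) = ⌊√⌊log₂ m⌋⌋`: for every exponent `c`,
threshold `d₀` and `δ, ε > 0`, from some `m₀` on one has `d₀ ≤ d(m)`, `d(m) ≤ ε ln m` and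
`m^c + c < m^{d(m)^δ}` (take `m₀ = 2^{M²}`, `M = max(d₀, ⌈(c+1)^{1/δ}⌉, ⌈1/(ε ln 2)⌉, 2)`). [folklore] -/
theorem sqrt_log_window_arith (c d₀ : ℕ) {δ ε : ℝ} (hδ : 0 < δ) (hε : 0 < ε) :
    ∃ m₀ : ℕ, ∀ m : ℕ, m₀ ≤ m →
      d₀ ≤ Nat.sqrt (Nat.log 2 m) ∧
      ((Nat.sqrt (Nat.log 2 m) : ℕ) : ℝ) ≤ ε * Real.log m ∧
      ((m ^ c + c : ℕ) : ℝ) < (m : ℝ) ^ (((Nat.sqrt (Nat.log 2 m) : ℕ) : ℝ) ^ δ) := by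
  set K : ℕ := ⌈((c : ℝ) + 1) ^ δ⁻¹⌉₊ with hK
  set S : ℕ := ⌈(ε * Real.log 2)⁻¹⌉₊ with hS
  set M : ℕ := max (max d₀ K) (max S 2) with hM
  refine ⟨2 ^ (M * M), fun m hm => ?_⟩
  have hM2 : 2 ≤ M := le_max_of_le_right (le_max_right _ _)
  have hMM : 1 ≤ M * M := Nat.one_le_iff_ne_zero.2 (Nat.mul_ne_zero (by omega) (by omega))
  have hm2 : 2 ≤ m := by
    calc 2 = 2 ^ 1 := (pow_one 2).symm
      _ ≤ 2 ^ (M * M) := Nat.pow_le_pow_right (by norm_num) hMM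
      _ ≤ m := hm
  have hm0 : m ≠ 0 := by omega
  -- `M² ≤ ⌊log₂ m⌋`, hence `M ≤ d(m)`
  set L : ℕ := Nat.log 2 m with hL
  have hlogM : M * M ≤ L := by
    have h := Nat.log_mono_right (b := 2) hm
    rwa [Nat.log_pow (by norm_num : 1 < 2)] at h
  set s : ℕ := Nat.sqrt L with hs
  have hMs : M ≤ s := Nat.le_sqrt.2 hlogM
  have hd₀ : d₀ ≤ s := ((le_max_left _ _).trans (le_max_left _ _)).trans hMs
  have hKs : K ≤ s := ((le_max_right _ _).trans (le_max_left _ _)).trans hMs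
  have hSs : S ≤ s := ((le_max_left _ _).trans (le_max_right _ _)).trans hMs
  refine ⟨hd₀, ?_, ?_⟩
  · -- `d(m) ≤ d(m)² · (ε ln 2) ≤ ⌊log₂ m⌋ · ε ln 2 ≤ ε ln m`
    have hpos : 0 < ε * Real.log 2 := mul_pos hε (Real.log_pos (by norm_num : (1:ℝ) < 2))
    have hSle : (ε * Real.log 2)⁻¹ ≤ (s : ℝ) := (Nat.le_ceil _).trans (by exact_mod_cast hSs)
    have h1 : (1 : ℝ) ≤ (s : ℝ) * (ε * Real.log 2) := by
      calc (1 : ℝ) = (ε * Real.log 2)⁻¹ * (ε * Real.log 2) := (inv_mul_cancel₀ hpos.ne').symm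
        _ ≤ (s : ℝ) * (ε * Real.log 2) := mul_le_mul_of_nonneg_right hSle hpos.le
    have hss : ((s * s : ℕ) : ℝ) ≤ (L : ℝ) := by exact_mod_cast Nat.sqrt_le L
    have hLm : (L : ℝ) * Real.log 2 ≤ Real.log m := by
      have h2L : ((2 ^ L : ℕ) : ℝ) ≤ (m : ℝ) := by exact_mod_cast Nat.pow_log_le_self 2 hm0
      have := Real.log_le_log (by positivity) h2L
      rw [Nat.cast_pow, Nat.cast_ofNat, Real.log_pow] at this
      exact this
    calc (s : ℝ) ≤ (s : ℝ) * ((s : ℝ) * (ε * Real.log 2)) :=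
          le_mul_of_one_le_right (Nat.cast_nonneg s) h1
      _ = ((s * s : ℕ) : ℝ) * (ε * Real.log 2) := by push_cast; ring
      _ ≤ (L : ℝ) * (ε * Real.log 2) := mul_le_mul_of_nonneg_right hss hpos.le
      _ = ε * ((L : ℝ) * Real.log 2) := by ring
      _ ≤ ε * Real.log m := mul_le_mul_of_nonneg_left hLm hε.le
  · -- `m^c + c < m^(c+1) ≤ m^{d(m)^δ}` since `c + 1 ≤ K^δ ≤ d(m)^δ`
    have hc1 : (0 : ℝ) ≤ (c : ℝ) + 1 := by positivity
    have hexp : (c : ℝ) + 1 ≤ (s : ℝ) ^ δ := by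
      calc (c : ℝ) + 1 = (((c : ℝ) + 1) ^ δ⁻¹) ^ δ := (Real.rpow_inv_rpow hc1 hδ.ne').symm
        _ ≤ (K : ℝ) ^ δ := Real.rpow_le_rpow (Real.rpow_nonneg hc1 _) (Nat.le_ceil _) hδ.le
        _ ≤ (s : ℝ) ^ δ := Real.rpow_le_rpow (Nat.cast_nonneg K) (by exact_mod_cast hKs) hδ.le
    have hm1 : (1 : ℝ) ≤ m := by exact_mod_cast (show 1 ≤ m by omega)
    have hnat : m ^ c + c < m ^ (c + 1) := by
      have h2c : c < 2 ^ c := Nat.lt_two_pow_self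
      have hpow : 2 ^ c ≤ m ^ c := Nat.pow_le_pow_left hm2 c
      have : m ^ (c + 1) = m ^ c * m := pow_succ _ _
      nlinarith
    calc ((m ^ c + c : ℕ) : ℝ) < ((m ^ (c + 1) : ℕ) : ℝ) := by exact_mod_cast hnat
      _ = (m : ℝ) ^ ((c : ℝ) + 1) := by
          rw [show ((c : ℝ) + 1) = ((c + 1 : ℕ) : ℝ) by push_cast; ring, Real.rpow_natCast]
          push_cast; ring
      _ ≤ (m : ℝ) ^ ((s : ℝ) ^ δ) := Real.rpow_le_rpow_of_exponent_le hm1 hexp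

/-- **Constant product depth is hard for `IMM_{m,⌊√⌊log₂ m⌋⌋}`, for GENERAL circuits** (the tree's LST
fact at the dial's degree function): for every `c`, from some `m₀` on, every circuit of product-depth
`≤ c` computing `IMM_{m,⌊√⌊log₂ m⌋⌋}` over `ℂ` has more than `m^c + c` gates.
[cite: LimayeSrinivasanTavenas2025, Cor. 4] -/
theorem immHard_constDepth (c : ℕ) : ∃ m₀ : ℕ, ∀ m : ℕ, m₀ ≤ m →
    ∀ D : ArithCircuit ℂ (Fin (Nat.sqrt (Nat.log 2 m)) × Fin m × Fin m),
      D.Computes (immPoly m (Nat.sqrt (Nat.log 2 m)) ℂ) → D.productDepth ≤ c →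
        m ^ c + c < D.size := by
  classical
  obtain ⟨δ, hδ, ε, hε, d₀, hL⟩ := lst_constantDepth_imm_lower_bound_holds ℂ (c + 1) (by omega)
  obtain ⟨m₀, hm₀⟩ := sqrt_log_window_arith c d₀ hδ hε
  refine ⟨m₀, fun m hm D hDc hDd => ?_⟩
  obtain ⟨hd₀, hdlog, hlt⟩ := hm₀ m hm
  have hlow := hL m (Nat.sqrt (Nat.log 2 m)) hd₀ hdlog D (hDd.trans (Nat.le_succ c)) hDc
  have h : ((m ^ c + c : ℕ) : ℝ) < (D.size : ℝ) := hlt.trans_le hlow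
  exact_mod_cast h

/-- **Floor of the rate dial, kernel**: `HomImmHardAt p 0` (`⌊p·L/0⌋ = 0`: constant depth).
[cite: LimayeSrinivasanTavenas2025, Cor. 4] -/
theorem homImmHardAt_zero_right (p : ℕ) : HomImmHardAt p 0 := by
  intro c
  obtain ⟨m₀, hm₀⟩ := immHard_constDepth c
  refine ⟨m₀, fun m hm D _ hDc hDd => hm₀ m hm D hDc ?_⟩
  simpa using hDd

/-- **Floor of the rate dial, kernel**: `HomImmHardAt 0 q` (slope `0`: constant depth).
[cite: LimayeSrinivasanTavenas2025, Cor. 4] -/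
theorem homImmHardAt_zero_left (q : ℕ) : HomImmHardAt 0 q := by
  intro c
  obtain ⟨m₀, hm₀⟩ := immHard_constDepth c
  refine ⟨m₀, fun m hm D _ hDc hDd => hm₀ m hm D hDc ?_⟩
  simpa using hDd

/-- The dial's two print/kernel anchors side by side: the floor `HomImmHardAt 0 1` is a theorem, and
with ANY homogenisation at slope `0` — which is false in print (it would put `IMM` in constant
homogeneous depth) — the dial law would close the crux; recorded only to show the law is not vacuous
at the floor. [cite: LimayeSrinivasanTavenas2025, Cor. 4, Lemma 11] -/
theorem perHardLog3_of_homAtSlope_zero (h : HomAtSlope 0 1) : Theses.DepthWindow.PerHardLog3 :=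
  perHardLog3_of_slopeRate h (homImmHardAt_zero_left 1)

end

end Summit.ValiantsHypothesis.ValiantsHypothesis.Theorems.DepthWindow
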